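import Summits.RiemannHypothesis.RiemannHypothesis.Theorems.IntegerScrewSmoothSectorDefs
import Summits.RiemannHypothesis.RiemannHypothesis.Theorems.ScrewLemmaKCoprofileDefs
import Summits.RiemannHypothesis.RiemannHypothesis.Theorems.ScrewLemmaKCoprofileCalculus
import Summits.RiemannHypothesis.RiemannHypothesis.Theorems.ScrewLemmaKCoprofileMellin
import Summits.RiemannHypothesis.RiemannHypothesis.Theorems.ScrewLemmaKCoprofileSquareIntegrable
import HarnessLib

/-!
# Route `ScrewLemmaKCoprofile`, support item `CoprofileParseval` (stmt-RiemannHypothesis-22439) —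
# the L17↔L14 bridge

CO-PROFILE PARSEVAL: for every admissible generator `g`,

  `∫₀¹ Φ_g(t)² dt = (2π)⁻¹ ∫_ℝ ‖∫₀¹ g′(u) u^{−1/2+iτ} du‖² · ‖ζ(3/2+iτ)‖² dτ`,

`Φ_g(t) = Σ_{n ≤ 1/t} g′(nt)/n`.  Proof: `Φ_g ∈ L²(0,1)` (`memLp_two_latticeCoprofile`), `g′` is
bounded on `(0,1)` (`exists_bound_deriv_Ioo`), and `latticeCoprofile_parseval_of_memLp` (Müntz in
the half-plane of absolute convergence on the line `s = 3/2 + iτ` through the tree's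
`mellin_tsum_comp_mul_nat`, then the tree's Mellin–Plancherel `integral_norm_sq_mellin_half_eq` at
`Re s = 1/2`).  The right-hand Bochner integral is an honest one: its integrand is integrable
(`integrable_coprofileBoundaryEnergy`).  No analytic continuation.  RH-free; nothing here bears on
the truth of RH.

Main results: `coprofileParseval` — the VERBATIM signature of item stmt-RiemannHypothesis-22439
(the by-name closer `… : Theses.ScrewLemmaKCoprofile.CoprofileParseval` is appended once the gate
renders that decl into the route file); `integrable_coprofileBoundaryEnergy`.
-/

set_option linter.dupNamespace false

noncomputable section

namespace Summit.RiemannHypothesis.RiemannHypothesis.Theorems.ScrewLemmaKCoprofile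

open MeasureTheory Set
open Summit.RiemannHypothesis.RiemannHypothesis.Theorems.IntegerScrew (SmoothSectorAdmissible)

/-- **Co-profile Parseval** (item stmt-RiemannHypothesis-22439, verbatim signature): for admissible
`g`, `∫₀¹ Φ_g² = (2π)⁻¹ ∫_ℝ ‖∫₀¹ g′(u)u^{−1/2+iτ} du‖² ‖ζ(3/2+iτ)‖² dτ`.
[cite: Titchmarsh1986, §2.11] -/
theorem coprofileParseval :
    ∀ g : ℝ → ℝ, SmoothSectorAdmissible g →
      (∫ t in Set.Ioo (0:ℝ) 1, (∑ n ∈ Finset.Icc 1 ⌊1 / t⌋₊, deriv g (n * t) / n) ^ 2)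
        = (1 / (2 * Real.pi)) * ∫ t : ℝ, ‖∫ u in Set.Ioo (0:ℝ) 1, ((deriv g u : ℝ) : ℂ)
            * (u : ℂ) ^ (-(1 / 2 : ℂ) + t * Complex.I)‖ ^ 2
              * ‖riemannZeta (3 / 2 + t * Complex.I)‖ ^ 2 := by
  intro g hg
  obtain ⟨B, hB⟩ := exists_bound_deriv_Ioo hg.1
  exact latticeCoprofile_parseval_of_memLp hB (memLp_two_latticeCoprofile hg.1)

/-- For admissible `g` the weighted boundary energy
`τ ↦ ‖∫₀¹ g′(u)u^{−1/2+iτ} du‖² ‖ζ(3/2+iτ)‖²` is integrable on `ℝ` (it is the Mellin–Plancherel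
integrand `‖𝓜Φ_g(1/2+iτ)‖²`), so the Parseval right-hand side is not a junk Bochner value; this
also discharges the integrability proviso of L14's `HardyThreePointBound`. [folklore] -/
theorem integrable_coprofileBoundaryEnergy {g : ℝ → ℝ} (hg : SmoothSectorAdmissible g) :
    Integrable (fun t : ℝ => ‖∫ u in Set.Ioo (0:ℝ) 1, ((deriv g u : ℝ) : ℂ)
        * (u : ℂ) ^ (-(1 / 2 : ℂ) + t * Complex.I)‖ ^ 2
          * ‖riemannZeta (3 / 2 + t * Complex.I)‖ ^ 2) := by
  obtain ⟨B, hB⟩ := exists_bound_deriv_Ioo hg.1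
  exact integrable_boundaryEnergy_of_memLp hB (memLp_two_latticeCoprofile hg.1)

end Summit.RiemannHypothesis.RiemannHypothesis.Theorems.ScrewLemmaKCoprofile

end
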